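import Literature.IUT.HodgeTheaters.CoveringsErrata
import Literature.GroupTheory.ProPStronglyComplete
import Literature.AnabelianGeometry.AbsoluteAnabelian.AbsTopISemiAbsolute
import HarnessLib

/-!
# [IUTchI] Remark 2.5.3 (vi) (O3) — the PRO-`p` instance of the Nikolov–Segal input, PROVED (Serre's theorem)

Mochizuki, *Inter-universal Teichmüller theory I*, kurims manuscript (May 2020), Remark 2.5.3 (vi) (O3),
p. 56: "since `H` is topologically finitely generated …, it holds [cf. [NS], Theorem 1.1] that every
finite index subgroup of `H` is open in `H`".  abc-iut-L5-t6 typed the quoted input as the CLOSED named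
fact `Rmk253.FiniteIndexOpenOfTopFG` (cell FACT-LIST row F-1977; = Nikolov–Segal, *Ann. of Math.* 165
(2007) Thm. 1.1 for ALL topologically finitely generated profinite groups, whose proof uses the
classification of finite simple groups; Mathlib-vocabulary twin `Literature.GroupTheory.NikolovSegalStatement`).

This proof-only file records, IN THE CELL'S VOCABULARY, the classical special case that predates [NS]:
for PRO-`p` groups the statement is Serre's theorem (J.-P. Serre, *Galois Cohomology* I §4.2 ex. 6;
Dixon–du Sautoy–Mann–Segal, *Analytic pro-`p` groups*, Thm. 1.17), kernel-checked tonight twice and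
independently — `Literature.GroupTheory.isOpen_of_finiteIndex_of_proP` (`ProPStronglyComplete.lean`,
abc-iut-w5-d218, consumed BY NAME below) and `Literature.GroupTheory.ProP.isOpen_of_finiteIndex`
(`ProP/ProPFiniteIndexOpen.lean`, abc-iut-w5-d200):

* `Literature.GroupTheory.isPGroup_quotient_openNormalSubgroup_of_isProSigma_singleton` /
  `…_of_isProSet_singleton` — the cell's two spellings of "pro-`{p}`" ([CombGC] Def. 1.1 (ii)
  `SemiGraphs.IsProSigma {p}`, [AbsTopI] Def. 1.1 (iii) `AbsoluteAnabelian.IsProSet · {p}`: the only prime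
  dividing the order of a finite continuous quotient is `p`) imply the working hypothesis "every finite
  continuous quotient is a `p`-group";
* `Rmk253.finiteIndexOpenOfTopFG_of_isProSigma_singleton` / `…_of_isProSet_singleton` — the displayed
  body of `FiniteIndexOpenOfTopFG` for every profinite group `H` which is pro-`{p}` and
  `IsTopologicallyFinitelyGenerated` — e.g. maximal pro-`l` quotients `Δ^{(l)}`, PSC fundamental groups
  `Π_𝔊` at `Σ = {l}`, free pro-`l` groups of finite rank;
* `Rmk253.continuous_of_isProSigma_singleton` — hence ("Thus, the conditions (c) and (c^new) in fact
  hold automatically", (O3) p. 56, in the pro-`p` case) every homomorphism from such an `H` to a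
  profinite group is continuous (with `Rmk253.continuous_of_forall_finiteIndex_isOpen`).

Nothing here asserts F-1977 / Nikolov–Segal in general (the consumers at `Gal(k̄/k)`, `k/ℚ_p` finite,
and at `π̂₁` of semi-graphs of anabelioids are NOT pro-`p`); nothing takes a side on [IUTchIII] Cor. 3.12.
[cite: Mochizuki2012, IUTchI Rmk 2.5.3 (vi) (O3) p.56] [cite: DixonDuSautoyMannSegal1999, Ch. 1 Thm. 1.17]
[cite: SerreGaloisCohomology1997, I §4.2 ex. 6]
-/

universe u

open Topology

namespace Literature.GroupTheory

/-- From "the only prime dividing the order of a finite continuous quotient is `p`" (the cell's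
[CombGC]-style `SemiGraphs.IsProSigma {p}`) to "every finite continuous quotient is a `p`-group".
[cite: DixonDuSautoyMannSegal1999, Ch. 1 §1.2] -/
theorem isPGroup_quotient_openNormalSubgroup_of_isProSigma_singleton {G : Type u} [Group G]
    [TopologicalSpace G] [IsTopologicalGroup G] [CompactSpace G] {p : ℕ} [Fact p.Prime]
    (hG : AnabelianGeometry.SemiGraphs.IsProSigma {p} G) (U : OpenNormalSubgroup G) :
    IsPGroup p (G ⧸ (U : Subgroup G)) := by
  refine isPGroup_quotient_openNormalSubgroup_of_index (fun V => exists_index_eq_pow_of_prime_dvd V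
    fun q hq hqd => ?_) U
  haveI : Finite (G ⧸ V.toSubgroup) := Subgroup.quotient_finite_of_isOpen V.toSubgroup V.isOpen
  exact hG.prime_mem V inferInstance q hq (by rwa [← Subgroup.index_eq_card])

/-- The same from the [AbsTopI] phrasing `AbsoluteAnabelian.IsProSet G {p}` ("the index of every open
normal subgroup is a product of primes of `{p}`"). [cite: DixonDuSautoyMannSegal1999, Ch. 1 §1.2] -/
theorem isPGroup_quotient_openNormalSubgroup_of_isProSet_singleton {G : Type u} [Group G]
    [TopologicalSpace G] [IsTopologicalGroup G] [CompactSpace G] {p : ℕ} [Fact p.Prime]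
    (hG : AnabelianGeometry.AbsoluteAnabelian.IsProSet G {p}) (U : OpenNormalSubgroup G) :
    IsPGroup p (G ⧸ (U : Subgroup G)) :=
  isPGroup_quotient_openNormalSubgroup_of_index (fun V => exists_index_eq_pow_of_prime_dvd V
    fun q hq hqd => hG.prime_dvd_index V.toSubgroup V.isNormal' V.isOpen q hq hqd) U

/-- The cell's `IsTopologicallyFinitelyGenerated` ([AbsTopI] §0) in the "finite subset generating a
dense subgroup" form. [cite: MochizukiAbsTopI2012, §0 p.8] -/
theorem exists_finset_dense_of_isTopologicallyFinitelyGenerated {G : Type u} [Group G]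
    [TopologicalSpace G] [IsTopologicalGroup G]
    (hG : AnabelianGeometry.AbsoluteAnabelian.IsTopologicallyFinitelyGenerated G) :
    ∃ S : Finset G, Dense ((Subgroup.closure (S : Set G) : Subgroup G) : Set G) := by
  obtain ⟨s, hs⟩ := hG.exists_finset
  refine ⟨s, ?_⟩
  rw [dense_iff_closure_eq, ← Subgroup.topologicalClosure_coe, hs, Subgroup.coe_top]

end Literature.GroupTheory

namespace Literature.IUT.HodgeTheaters.Rmk253

open Literature.AnabelianGeometry

/-- **[IUTchI] Remark 2.5.3 (vi) (O3), the Nikolov–Segal input — PRO-`p` INSTANCE PROVED (Serre's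
theorem).** For every profinite group `H` which is pro-`{p}` (`SemiGraphs.IsProSigma {p} H`) and
topologically finitely generated, every subgroup of finite index is open — the body of the named fact
`FiniteIndexOpenOfTopFG` (F-1977) at such `H`. [cite: Mochizuki2012, IUTchI Rmk 2.5.3 (vi) (O3) p.56]
[cite: DixonDuSautoyMannSegal1999, Ch. 1 Thm. 1.17] -/
theorem finiteIndexOpenOfTopFG_of_isProSigma_singleton (p : ℕ) [Fact p.Prime]
    (H : ProfiniteGrp.{u}) (hp : SemiGraphs.IsProSigma {p} H)
    (hH : AbsoluteAnabelian.IsTopologicallyFinitelyGenerated H)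
    (U : Subgroup H) (hU : U.FiniteIndex) : IsOpen (U : Set H) :=
  Literature.GroupTheory.isOpen_of_finiteIndex_of_proP
    (Literature.GroupTheory.isPGroup_quotient_openNormalSubgroup_of_isProSigma_singleton hp)
    (Literature.GroupTheory.exists_finset_dense_of_isTopologicallyFinitelyGenerated hH) U

/-- The same over the [AbsTopI] predicate `AbsoluteAnabelian.IsProSet H {p}` (pro-`Σ`, `Σ = {p}`).
[cite: Mochizuki2012, IUTchI Rmk 2.5.3 (vi) (O3) p.56] [cite: DixonDuSautoyMannSegal1999, Ch. 1 Thm. 1.17] -/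
theorem finiteIndexOpenOfTopFG_of_isProSet_singleton (p : ℕ) [Fact p.Prime]
    (H : ProfiniteGrp.{u}) (hp : AbsoluteAnabelian.IsProSet H {p})
    (hH : AbsoluteAnabelian.IsTopologicallyFinitelyGenerated H)
    (U : Subgroup H) (hU : U.FiniteIndex) : IsOpen (U : Set H) :=
  Literature.GroupTheory.isOpen_of_finiteIndex_of_proP
    (Literature.GroupTheory.isPGroup_quotient_openNormalSubgroup_of_isProSet_singleton hp)
    (Literature.GroupTheory.exists_finset_dense_of_isTopologicallyFinitelyGenerated hH) U

/-- Consequently ("Thus, the conditions (c) and (c^new) in fact hold automatically", (O3) p. 56, in the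
pro-`p` case): every homomorphism from a topologically finitely generated pro-`{p}` profinite group to a
profinite group is continuous. [cite: Mochizuki2012, IUTchI Rmk 2.5.3 (vi) (O3) p.56] -/
theorem continuous_of_isProSigma_singleton (p : ℕ) [Fact p.Prime]
    (H : ProfiniteGrp.{u}) (hp : SemiGraphs.IsProSigma {p} H)
    (hH : AbsoluteAnabelian.IsTopologicallyFinitelyGenerated H)
    {K : Type u} [Group K] [TopologicalSpace K] [IsTopologicalGroup K] [CompactSpace K]
    [TotallyDisconnectedSpace K] (f : H →* K) : Continuous f :=
  continuous_of_forall_finiteIndex_isOpen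
    (fun U hU => finiteIndexOpenOfTopFG_of_isProSigma_singleton p H hp hH U hU) f

end Literature.IUT.HodgeTheaters.Rmk253
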